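import Literature.Computability.Complexity.GateEliminationCase54Q23And
import Literature.Computability.Complexity.GateEliminationDimension

/-!
# Gate elimination: Case 5.4.1.4.2.4 of Li–Yang's Theorem 4.1 with `u' = y`

The variant of Case 5.4.1.4.2.4 (ECCC TR21-023, §4.1) in which the variable `u'` read by the
⊕-type `2`-gate `F` (the other reader of `D`) is `y` itself (so `F = C'`, and `y` is only a
`1`-variable once `G` is gone). Here three substitutions free four variables: `t := c` trivializing
`E`; `x := c'` trivializing `G` (then `D = u ⊕ const` is bypassed, so `F` reads `u` and `y`, both
`1`-variables); `u ← y ⊕ c''` making `F` a constant gate, eliminated: `t`, `x`, `u`, `y` leave the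
influential set, `Δμ ≥ 4α_I ≥ 3δ`. PROVED here as `stepGoal_quad23_xor_y`.

## References

* J. Li, T. Yang, *3.1n − o(n) circuit lower bounds for explicit functions*, STOC 2022;
  ECCC TR21-023, §2.4, §4.1 (Case 5.4.1.4.2.4), Lemma 3.11.
-/

namespace Literature.Computability.Complexity

open Finset

namespace Semicircuit

variable {n : ℕ} {C : Semicircuit n} {f : (Fin n → ZMod 2) → Bool} {R : RdqSource n} {d : ℕ}
  {αφ αI αQ : ℝ} {G : Fin C.m} {x y : Fin n} {B C' D : Fin C.m} {aX aB aC aD : Fin 2}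

/-- **Case 5.4.1.4.2.4 of the proof of Thm. 4.1 with `u' = y`** (see the module docstring).
[cite: LiYang2022, §4.1 (Case 5.4.1.4.2.4)] -/
theorem stepGoal_quad23_xor_y (hf : IsAffineDisperser f d) (hd : 2 * d + 2 < R.dim) (hF : C.Fair)
    (hC : C.ComputesRestr f R) (hS : C.Standing R) (hcfg : C.Case5Config G x y B C' D aX aB aC aD)
    (hφ0 : 0 < αφ) (hφ : αφ < 1 / 2) (hI0 : 0 < αI) (hnDB : ¬ C.Reads D B)
    {E : Fin C.m} {aE : Fin 2} {u : Fin n} (hDn : ¬ IsAndOp (C.op D)) (hIu : C.arg D aD.rev = .var u)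
    (hup : ¬ R.Protected u) (hu1 : C.fanout (.var u) = 1) (hD2 : C.fanout (.gate D) = 2)
    (hEand : IsAndOp (C.op E)) (hED : C.arg E aE = .gate D)
    {t : Fin n} {F : Fin C.m} {aF : Fin 2} (hEt : C.arg E aE.rev = .var t) (hFE : F ≠ E)
    (hFD : C.arg F aF = .gate D) (hFy : C.arg F aF.rev = .var y) (hyt : y ≠ t) (hFn : ¬ IsAndOp (C.op F)) :
    C.StepGoal f R αφ αI αQ := by
  classical
  have hφ' := hφ0.le
  have hI' := hI0.le
  have hN := hS.normalized.1
  have hGK := hcfg.G_not_mem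
  have hDK : D ∉ C.xorPart := fun hDK => hGK (C.mem_of_arg_eq D hDK aD G hcfg.arg_D)
  have hEK : E ∉ C.xorPart := C.not_mem_xorPart_of_isAndOp hEand
  have hFK : F ∉ C.xorPart := fun h => hDK (C.mem_of_arg_eq F h aF D hFD)
  have hFxor : IsXorOp (C.op F) := C.isXorOp_of_isAffineOp hS.nonDegenerate ((isAndOp_or_isAffineOp _).resolve_left hFn)
  obtain ⟨dD, hdD⟩ : IsXorOp (C.op D) := C.isXorOp_of_isAffineOp hS.nonDegenerate ((isAndOp_or_isAffineOp _).resolve_left hDn)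
  have hED' : E ≠ D := fun h => by rw [h] at hED; exact C.arg_ne_self_of_not_mem hDK _ hED
  have hFD' : F ≠ D := fun h => by rw [h] at hFD; exact C.arg_ne_self_of_not_mem hDK _ hFD
  have hDG := hcfg.D_ne_G
  have hEG : E ≠ G := by
    intro h; rw [h] at hED
    rcases fin2_eq_or_eq_rev aX aE with e' | e'
    · rw [e', hcfg.arg_G_x] at hED; cases hED
    · rw [e', hcfg.arg_G_y] at hED; cases hED
  have hFG : F ≠ G := by
    intro h; rw [h] at hFD
    rcases fin2_eq_or_eq_rev aX aF with e' | e'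
    · rw [e', hcfg.arg_G_x] at hFD; cases hFD
    · rw [e', hcfg.arg_G_y] at hFD; cases hFD
  have hux : u ≠ x := fun h => case5_D_not_x hS hcfg aD.rev (by rw [hIu, h])
  have huy : u ≠ y := fun h => case5_D_not_y hS hcfg aD.rev (by rw [hIu, h])
  have htu : t ≠ u := by intro h; rw [h] at hEt; have := two_le_fanout hIu hEt hED'.symm; omega
  have hEB : E ≠ B := fun h => hnDB ⟨aE, by rw [← h]; exact hED⟩
  have htx : t ≠ x := by
    intro h; rw [h] at hEt
    rcases case5_reader_x hcfg hEt with h' | h'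
    · exact hEG h'
    · exact hEB h'
  have ht : R.Free t := free_of_reads hC hEt
  have htp : ¬ R.Protected t := fun h => hS.protected_not_and t h E aE.rev hEt hEand
  have hx : R.Free x := case5_free_x hC hcfg
  have hxp : ¬ R.Protected x := case5_unprot_x hS hcfg
  have hy : R.Free y := free_of_reads hC hcfg.arg_G_y
  have hyp : ¬ R.Protected y := case5_unprot_y hS hcfg
  have hu : R.Free u := free_of_reads hC hIu
  have hGout : C.out ≠ .gate G := out_ne_of_read_bYacyclic hS hDK ⟨aD, hcfg.arg_D⟩
  obtain ⟨ko, hko⟩ := exists_out_eq_gate' hf hF hC (by omega)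
  -- readers of `y`: `G` and `F`; readers of `u`: `D`; readers of `D`: `E`, `F`
  have hready : ∀ k a, C.arg k a = .var y → k = G ∨ k = F := by
    intro k a h
    rcases case5_reader_y hcfg h with h' | h'
    · exact Or.inl h'
    · right
      -- `C' = F`: both are "the other reader of `y`"
      by_contra hkF
      have := three_le_fanout hcfg.arg_G_y hFy h hFG.symm (fun h'' => hcfg.C_ne_G.symm (h'' ▸ h'.symm ▸ rfl)) (fun h'' => hkF h''.symm)
      have := hcfg.fanout_y; omega
  have hreadu : ∀ k a, C.arg k a = .var u → k = D := by
    intro k a h; by_contra hk; have := two_le_fanout hIu h (fun h' => hk h'.symm); omega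
  -- step 1: `t := c₁` killing `E`
  obtain ⟨c₁, hc₁⟩ := exists_trivializing hEand aE.rev
  let c₁' : ZMod 2 := finTwoEquiv.symm c₁
  have hc₁' : finTwoEquiv c₁' = c₁ := finTwoEquiv.apply_symm_apply c₁
  let C₁ := C.substConst t (finTwoEquiv c₁')
  let R₁ := R.assignFree t c₁' ht htp
  have hF₁ : C₁.Fair := hF.substConst t _
  have hC₁ : C₁.ComputesRestr f R₁ := hC.substConst_assignFree ht htp c₁'
  have hP₁ : C₁.IsPacking (C.substConstPacking t (finTwoEquiv c₁') ∅) := C.isPacking_empty.substConst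
  have hvar₁ : ∀ {k : Fin C.m} {a : Fin 2} {v : Fin n}, v ≠ t → (C₁.arg k a = .var v ↔ C.arg k a = .var v) := by
    intro k a v hvt
    show (C.arg k a).substConst t _ = .var v ↔ _
    cases hka : C.arg k a with
    | const c => exact ⟨(fun h => by cases h), fun h => by cases h⟩
    | var i =>
      by_cases hit : i = t
      · rw [hit, Node.substConst_var_self]; exact ⟨(fun h => by cases h), fun h => by cases h; exact absurd rfl hvt⟩
      · rw [Node.substConst_var_of_ne hit]
    | gate g => exact ⟨(fun h => by cases h), fun h => by cases h⟩
  have hgate₁ : ∀ {k : Fin C.m} {a : Fin 2} {g : Fin C.m}, C₁.arg k a = .gate g ↔ C.arg k a = .gate g :=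
    fun {k a g} => Node.substConst_eq_gate_iff
  have hEt₁ : C₁.arg E aE.rev = .const c₁ := by
    show (C.arg E aE.rev).substConst t _ = _; rw [hEt, Node.substConst_var_self]
    show Node.const (finTwoEquiv c₁') = Node.const c₁; rw [hc₁']
  have hC₁out : C₁.out = .gate ko := by show C.out.substConst t _ = _; rw [hko]; rfl
  have htrivE : C₁.liveFn E aE.rev c₁ false = C₁.liveFn E aE.rev c₁ true := hc₁
  have hout₁E : C₁.out ≠ .gate E := out_ne_of_trivialized hf (by
    have := RdqSource.dim_assignFree (b := c₁') ht htp; change R₁.dim + 1 = R.dim at this; omega) hF₁ hC₁ hEt₁ htrivE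
  let E₁ := elimDataWTriv hF₁ hC₁ hP₁ hEt₁ htrivE hout₁E hφ' hI' αQ
  have hr₁ : ∃ r₁, E₁.repl = .const r₁ := ⟨_, rfl⟩
  obtain ⟨kG₁, hkG₁⟩ := E₁.ι_surj G hEG.symm
  obtain ⟨kD₁, hkD₁⟩ := E₁.ι_surj D hED'.symm
  obtain ⟨kF₁, hkF₁⟩ := E₁.ι_surj F hFE
  have hG₁x : E₁.C'.arg kG₁ aX = .var x := by rw [E₁.arg_eq_var_iff, hkG₁]; exact Or.inl ((hvar₁ htx.symm).mpr hcfg.arg_G_x)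
  have hG₁y : E₁.C'.arg kG₁ aX.rev = .var y := by rw [E₁.arg_eq_var_iff, hkG₁]; exact Or.inl ((hvar₁ hyt).mpr hcfg.arg_G_y)
  have hD₁G : E₁.C'.arg kD₁ aD = .gate kG₁ := by rw [E₁.arg_eq_gate_iff, hkD₁, hkG₁]; exact Or.inl (hgate₁.mpr hcfg.arg_D)
  have hD₁u : E₁.C'.arg kD₁ aD.rev = .var u := by rw [E₁.arg_eq_var_iff, hkD₁]; exact Or.inl ((hvar₁ htu.symm).mpr hIu)
  have hF₁D : E₁.C'.arg kF₁ aF = .gate kD₁ := by rw [E₁.arg_eq_gate_iff, hkF₁, hkD₁]; exact Or.inl (hgate₁.mpr hFD)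
  have hF₁y : E₁.C'.arg kF₁ aF.rev = .var y := by rw [E₁.arg_eq_var_iff, hkF₁]; exact Or.inl ((hvar₁ hyt).mpr hFy)
  have hopG₁ : E₁.C'.op kG₁ = C.op G := by rw [elimDataWTriv_op, hkG₁]
  have hopD₁ : E₁.C'.op kD₁ = C.op D := by rw [elimDataWTriv_op, hkD₁]
  have hxorF₁ : IsXorOp (E₁.C'.op kF₁) := E₁.isXorOp_of (by rw [hkF₁]; exact hFxor)
  have hkDG₁ : kD₁ ≠ kG₁ := fun h => hDG (by rw [← hkD₁, ← hkG₁, h])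
  have hkFG₁ : kF₁ ≠ kG₁ := fun h => hFG (by rw [← hkF₁, ← hkG₁, h])
  have hkFD₁ : kF₁ ≠ kD₁ := fun h => hFD' (by rw [← hkF₁, ← hkD₁, h])
  -- readers of `y`, `u` in `E₁.C'`
  have hready₁ : ∀ k a, E₁.C'.arg k a = .var y → k = kG₁ ∨ k = kF₁ := by
    intro k a h
    obtain ⟨r₁, hr₁'⟩ := hr₁
    rw [E₁.arg_eq_var_iff] at h
    rcases h with h | ⟨-, h⟩
    swap; · rw [hr₁'] at h; cases h
    rw [hvar₁ hyt] at h
    rcases hready _ a h with h' | h'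
    · left; exact E₁.ι_injective (h'.trans hkG₁.symm)
    · right; exact E₁.ι_injective (h'.trans hkF₁.symm)
  have hreadu₁ : ∀ k a, E₁.C'.arg k a = .var u → k = kD₁ := by
    intro k a h
    obtain ⟨r₁, hr₁'⟩ := hr₁
    rw [E₁.arg_eq_var_iff] at h
    rcases h with h | ⟨-, h⟩
    swap; · rw [hr₁'] at h; cases h
    rw [hvar₁ htu.symm] at h
    exact E₁.ι_injective ((hreadu _ a h).trans hkD₁.symm)
  -- step 2: `x := c₂` killing `G`
  obtain ⟨c₂, hc₂⟩ := exists_trivializing hcfg.and_G aX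
  let c₂' : ZMod 2 := finTwoEquiv.symm c₂
  have hc₂' : finTwoEquiv c₂' = c₂ := finTwoEquiv.apply_symm_apply c₂
  have hx₁ : R₁.Free x := (RdqSource.free_assignFree_iff ht htp x).mpr ⟨hx, htx.symm⟩
  have hxp₁ : ¬ R₁.Protected x := fun h => hxp ((RdqSource.protected_assignFree_iff ht htp x).mp h)
  let C₂ := E₁.C'.substConst x (finTwoEquiv c₂')
  let R₂ := R₁.assignFree x c₂' hx₁ hxp₁
  have hF₂ : C₂.Fair := E₁.fair.substConst x _
  have hC₂ : C₂.ComputesRestr f R₂ := E₁.computes.substConst_assignFree hx₁ hxp₁ c₂'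
  have hP₂ : C₂.IsPacking (E₁.C'.substConstPacking x (finTwoEquiv c₂') E₁.P') := E₁.packing.substConst
  have hd₂ : 2 * d + 1 ≤ R₂.dim := by
    have h1 := RdqSource.dim_assignFree (b := c₂') hx₁ hxp₁
    have h2 := RdqSource.dim_assignFree (b := c₁') ht htp
    change R₂.dim + 1 = R₁.dim at h1; change R₁.dim + 1 = R.dim at h2; omega
  have hG₂x : C₂.arg kG₁ aX = .const c₂ := by
    show (E₁.C'.arg kG₁ aX).substConst x _ = _; rw [hG₁x, Node.substConst_var_self]
    show Node.const (finTwoEquiv c₂') = Node.const c₂; rw [hc₂']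
  have hG₂y : C₂.arg kG₁ aX.rev = .var y := by
    show (E₁.C'.arg kG₁ aX.rev).substConst x _ = _; rw [hG₁y, Node.substConst_var_of_ne (fun h => hcfg.x_ne_y h.symm)]
  have hD₂G : C₂.arg kD₁ aD = .gate kG₁ := by show (E₁.C'.arg kD₁ aD).substConst x _ = _; rw [hD₁G]; rfl
  have hD₂u : C₂.arg kD₁ aD.rev = .var u := by show (E₁.C'.arg kD₁ aD.rev).substConst x _ = _; rw [hD₁u, Node.substConst_var_of_ne hux]
  have hF₂D : C₂.arg kF₁ aF = .gate kD₁ := by show (E₁.C'.arg kF₁ aF).substConst x _ = _; rw [hF₁D]; rfl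
  have hF₂y : C₂.arg kF₁ aF.rev = .var y := by
    show (E₁.C'.arg kF₁ aF.rev).substConst x _ = _; rw [hF₁y, Node.substConst_var_of_ne (fun h => hcfg.x_ne_y h.symm)]
  have hopG₂ : C₂.op kG₁ = C.op G := hopG₁
  have htrivG : C₂.liveFn kG₁ aX c₂ false = C₂.liveFn kG₁ aX c₂ true := by
    unfold liveFn at hc₂ ⊢; rw [hopG₂]; exact hc₂
  have hout₂G : C₂.out ≠ .gate kG₁ := out_ne_of_trivialized hf (by omega) hF₂ hC₂ hG₂x htrivG
  let E₂ := elimDataWTriv hF₂ hC₂ hP₂ hG₂x htrivG hout₂G hφ' hI' αQ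
  set cG := C₂.liveFn kG₁ aX c₂ false with hcG
  have hr₂ : E₂.repl = .const cG := rfl
  obtain ⟨kD₂, hkD₂⟩ := E₂.ι_surj kD₁ hkDG₁
  obtain ⟨kF₂, hkF₂⟩ := E₂.ι_surj kF₁ hkFG₁
  have hD₂c : E₂.C'.arg kD₂ aD = .const cG := (E₂.arg_eq_const_iff kD₂ aD cG).mpr (Or.inr ⟨by rw [hkD₂]; exact hD₂G, hr₂⟩)
  have hD₂u' : E₂.C'.arg kD₂ aD.rev = .var u := by rw [E₂.arg_eq_var_iff, hkD₂]; exact Or.inl hD₂u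
  have hF₂D' : E₂.C'.arg kF₂ aF = .gate kD₂ := by rw [E₂.arg_eq_gate_iff, hkF₂, hkD₂]; exact Or.inl hF₂D
  have hF₂y' : E₂.C'.arg kF₂ aF.rev = .var y := by rw [E₂.arg_eq_var_iff, hkF₂]; exact Or.inl hF₂y
  have hopD₂ : E₂.C'.op kD₂ = C.op D := by rw [elimDataWTriv_op, hkD₂]; show E₁.C'.op kD₁ = _; exact hopD₁
  have hxorF₂ : IsXorOp (E₂.C'.op kF₂) := by rw [elimDataWTriv_op, hkF₂]; exact hxorF₁
  have hkFD₂ : kF₂ ≠ kD₂ := fun h => hkFD₁ (by rw [← hkF₂, ← hkD₂, h])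
  -- step 3: bypass the degenerate `D` (= `u ⊕ const`)
  have hdegD : ∀ t', E₂.C'.liveFn kD₂ aD cG t' = (t' ^^ (cG ^^ dD)) := by
    intro t'
    show (if aD = 0 then E₂.C'.op kD₂ cG t' else E₂.C'.op kD₂ t' cG) = _
    split_ifs <;> rw [hopD₂, hdD] <;> cases t' <;> cases cG <;> cases dD <;> rfl
  have hout₂D : E₂.C'.out ≠ .gate kD₂ := out_ne_of_live_var' hf (by omega) E₂.fair E₂.computes hD₂c hD₂u'
  let E₃ := elimDataWBypass E₂.fair E₂.computes E₂.packing (cG ^^ dD) hD₂c hdegD hout₂D hφ' hI' αQ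
  have hr₃ : E₃.repl = .var u := hD₂u'
  obtain ⟨kF₃, hkF₃⟩ := E₃.ι_surj kF₂ hkFD₂
  have hF₃u : E₃.C'.arg kF₃ aF = .var u := by rw [E₃.arg_eq_var_iff, hkF₃]; exact Or.inr ⟨hF₂D', hr₃⟩
  have hF₃y : E₃.C'.arg kF₃ aF.rev = .var y := by rw [E₃.arg_eq_var_iff, hkF₃]; exact Or.inl hF₂y'
  have hxorF₃ : IsXorOp (E₃.C'.op kF₃) := E₃.isXorOp_of (by rw [hkF₃]; exact hxorF₂)
  -- readers of `y` and `u` in `E₃.C'`: only `F`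
  have hready₃ : ∀ k a, E₃.C'.arg k a = .var y → k = kF₃ := by
    intro k a h
    rw [E₃.arg_eq_var_iff] at h
    rcases h with h | ⟨-, h⟩
    swap; · rw [hr₃] at h; cases h; exact absurd rfl huy
    rw [E₂.arg_eq_var_iff] at h
    rcases h with h | ⟨-, h⟩
    swap; · rw [hr₂] at h; cases h
    change (E₁.C'.arg (E₂.ι (E₃.ι k)) a).substConst x (finTwoEquiv c₂') = .var y at h
    have h' : E₁.C'.arg (E₂.ι (E₃.ι k)) a = .var y := by
      cases hh : E₁.C'.arg (E₂.ι (E₃.ι k)) a with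
      | const c => rw [hh] at h; cases h
      | var i =>
        rw [hh] at h
        by_cases hix : i = x
        · rw [hix, Node.substConst_var_self] at h; cases h
        · rw [Node.substConst_var_of_ne hix] at h; cases h; rfl
      | gate g => rw [hh] at h; cases h
    rcases hready₁ _ a h' with h'' | h''
    · exact absurd h'' (E₂.ι_ne _)
    · exact E₃.ι_injective (E₂.ι_injective (h''.trans hkF₂.symm) |>.trans hkF₃.symm)
  have hreadu₃ : ∀ k a, E₃.C'.arg k a = .var u → k = kF₃ := by
    intro k a h
    rw [E₃.arg_eq_var_iff] at h
    rcases h with h | ⟨h, -⟩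
    · exfalso
      rw [E₂.arg_eq_var_iff] at h
      rcases h with h | ⟨-, h⟩
      swap; · rw [hr₂] at h; cases h
      change (E₁.C'.arg (E₂.ι (E₃.ι k)) a).substConst x (finTwoEquiv c₂') = .var u at h
      have h' : E₁.C'.arg (E₂.ι (E₃.ι k)) a = .var u := by
        cases hh : E₁.C'.arg (E₂.ι (E₃.ι k)) a with
        | const c => rw [hh] at h; cases h
        | var i =>
          rw [hh] at h
          by_cases hix : i = x
          · rw [hix, Node.substConst_var_self] at h; cases h
          · rw [Node.substConst_var_of_ne hix] at h; cases h; rfl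
        | gate g => rw [hh] at h; cases h
      have := hreadu₁ _ a h'
      exact E₃.ι_ne k (E₂.ι_injective (this.trans hkD₂.symm))
    · -- `k` reads `kD₂` in `E₂.C'`: it is `F` (the only remaining reader of `D`)
      rw [E₂.arg_eq_gate_iff] at h
      rcases h with h | ⟨-, h⟩
      swap; · rw [hr₂] at h; cases h
      change (E₁.C'.arg (E₂.ι (E₃.ι k)) a).substConst x (finTwoEquiv c₂') = .gate (E₂.ι kD₂) at h
      rw [Node.substConst_eq_gate_iff, hkD₂, E₁.arg_eq_gate_iff, hkD₁] at h
      rcases h with h | ⟨-, h⟩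
      swap; · obtain ⟨r₁, hr₁'⟩ := hr₁; rw [hr₁'] at h; cases h
      rw [hgate₁] at h
      -- readers of `D` in `C`: `E` (eliminated) and `F`
      have hk : E₁.ι (E₂.ι (E₃.ι k)) = F := by
        by_contra hkF
        have hkE : E₁.ι (E₂.ι (E₃.ι k)) ≠ E := E₁.ι_ne _
        have := three_le_fanout hED hFD h hFE.symm hkE.symm (fun h' => hkF h'.symm)
        omega
      exact E₃.ι_injective (E₂.ι_injective ((E₁.ι_injective (hk.trans hkF₁.symm)).trans hkF₂.symm) |>.trans hkF₃.symm)
  -- step 4: `u ← y`, then `F` is a constant gate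
  have hu₂ : R₂.Free u := (RdqSource.free_assignFree_iff hx₁ hxp₁ u).mpr ⟨(RdqSource.free_assignFree_iff ht htp u).mpr ⟨hu, htu.symm⟩, hux⟩
  have hup₂ : ¬ R₂.Protected u := fun h =>
    hup ((RdqSource.protected_assignFree_iff ht htp u).mp ((RdqSource.protected_assignFree_iff hx₁ hxp₁ u).mp h))
  have hy₂ : R₂.Free y := (RdqSource.free_assignFree_iff hx₁ hxp₁ y).mpr ⟨(RdqSource.free_assignFree_iff ht htp y).mpr ⟨hy, hyt⟩, fun h => hcfg.x_ne_y h.symm⟩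
  have hyp₂ : ¬ R₂.Protected y := fun h =>
    hyp ((RdqSource.protected_assignFree_iff ht htp y).mp ((RdqSource.protected_assignFree_iff hx₁ hxp₁ y).mp h))
  let Eq : LinEq n := ⟨{y}, 0⟩
  have hEq : ∀ i ∈ Eq.support, R₂.lin i = none ∧ i ≠ u := by
    intro i hi
    have : i = y := by simpa [Eq] using hi
    subst this
    exact ⟨hy₂.1, huy.symm⟩
  let R₃ := R₂.assignLin u Eq hu₂ hup₂ hEq
  have hsol : ∀ v, v ∈ R₃.Sol ↔ v ∈ R₂.Sol ∧ v u = v y + 0 := by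
    intro v
    rw [RdqSource.mem_sol_assignLin_iff]
    have : Eq.eval v = v y + 0 := by
      show (0 : ZMod 2) + ∑ i ∈ ({y} : Finset (Fin n)), v i = _
      rw [sum_singleton, add_comm]
    rw [this]
  have hfree : ∀ i, R₃.Free i ↔ R₂.Free i ∧ i ≠ u := RdqSource.free_assignLin_iff hu₂ hup₂ hEq
  have hdim₃ : R₃.dim + 3 = R.dim := by
    have h0 := RdqSource.dim_assignLin hu₂ hup₂ hEq
    have h1 := RdqSource.dim_assignFree (b := c₂') hx₁ hxp₁
    have h2 := RdqSource.dim_assignFree (b := c₁') ht htp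
    change R₃.dim + 1 = R₂.dim at h0; change R₂.dim + 1 = R₁.dim at h1; change R₁.dim + 1 = R.dim at h2; omega
  have hE₃out : ∃ g₃, E₃.C'.out = .gate g₃ := by
    have e1 := E₁.out_eq; rw [if_neg hout₁E, hC₁out] at e1
    have ho₁ : ∃ g₁, E₁.C'.out = .gate g₁ := by
      cases h1o : E₁.C'.out with
      | const cc => rw [h1o] at e1; change Node.const cc = Node.gate ko at e1; cases e1
      | var i => rw [h1o] at e1; change Node.var i = Node.gate ko at e1; cases e1
      | gate g₁ => exact ⟨g₁, rfl⟩
    obtain ⟨g₁, hg₁⟩ := ho₁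
    have hC₂out : C₂.out = .gate g₁ := by show (E₁.C'.out).substConst x _ = _; rw [hg₁]; rfl
    have e2 := E₂.out_eq; rw [if_neg hout₂G, hC₂out] at e2
    have ho₂ : ∃ g₂, E₂.C'.out = .gate g₂ := by
      cases h2o : E₂.C'.out with
      | const cc => rw [h2o] at e2; change Node.const cc = Node.gate g₁ at e2; cases e2
      | var i => rw [h2o] at e2; change Node.var i = Node.gate g₁ at e2; cases e2
      | gate g₂ => exact ⟨g₂, rfl⟩
    obtain ⟨g₂, hg₂⟩ := ho₂
    have e3 := E₃.out_eq; rw [if_neg hout₂D, hg₂] at e3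
    cases h3o : E₃.C'.out with
    | const cc => rw [h3o] at e3; change Node.const cc = Node.gate g₂ at e3; cases e3
    | var i => rw [h3o] at e3; change Node.var i = Node.gate g₂ at e3; cases e3
    | gate g₃ => exact ⟨g₃, rfl⟩
  have houtu : E₃.C'.out ≠ .var u := by obtain ⟨g₃, hg₃⟩ := hE₃out; rw [hg₃]; exact fun h => by cases h
  let C₄ := E₃.C'.substVar u y (finTwoEquiv (0 : ZMod 2))
  have hF₄ : C₄.Fair := E₃.fair.substVar u y _
  have hC₄ : C₄.ComputesRestr f R₃ := E₃.computes.substVar huy.symm hsol hfree hy₂ houtu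
  have hwF : ∀ a, C₄.arg kF₃ a = .var y := by
    intro a
    show (E₃.C'.arg kF₃ a).substVar u y = .var y
    rw [Node.substVar_eq_var_target_iff]
    rcases fin2_eq_or_eq_rev aF a with e' | e'
    · rw [e']; exact Or.inl hF₃u
    · rw [e']; exact Or.inr hF₃y
  have hready₄ : ∀ k a, C₄.arg k a = .var y → k = kF₃ := by
    intro k a h
    change (E₃.C'.arg k a).substVar u y = .var y at h
    rw [Node.substVar_eq_var_target_iff] at h
    rcases h with h | h
    · exact hreadu₃ k a h
    · exact hready₃ k a h
  have hxorF₄ : IsXorOp (C₄.op kF₃) := hxorF₃.comp_xor _ _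
  obtain ⟨P₄, hP₄, hpot₄⟩ := exists_packing_substVar_of_not_and E₃.C' u y (finTwoEquiv (0 : ZMod 2)) huy.symm E₃.packing
    (fun g a hg hand' => by rw [hready₄ g a hg] at hand'; exact hand'.not_isXorOp hxorF₄)
  obtain ⟨eF, heF⟩ := hxorF₄
  have hid : ∀ (xx : Fin n → Bool) (w : Fin C₄.m → Bool),
      C₄.op kF₃ (C₄.nodeVal xx w (C₄.arg kF₃ 0)) (C₄.nodeVal xx w (C₄.arg kF₃ 1)) = eF := by
    intro xx w
    rw [hwF 0, hwF 1, heF]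
    show ((xx y ^^ xx y) ^^ eF) = eF
    cases xx y <;> cases eF <;> rfl
  have hselfF : ∀ a, C₄.arg kF₃ a ≠ .gate kF₃ := by intro a h; rw [hwF a] at h; cases h
  have houtF : C₄.out ≠ .gate kF₃ :=
    out_ne_of_semConst hf (by omega) hF₄ hC₄ (fun xx w hw => by rw [hw kF₃]; exact hid xx w)
  let E₅ := elimDataWRedirectConst hF₄ hC₄ hP₄ eF hid (Or.inl (by rw [hwF 0, hwF 1])) hselfF houtF hφ' hI' αQ
  have hr₅ : E₅.repl = .const eF := rfl
  -- `y` is a `0`-variable afterwards, unprotected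
  have hfy₅ : E₅.C'.fanout (.var y) = 0 := by
    have h0 : ∀ k' a, E₅.C'.arg k' a ≠ .var y := by
      intro k' a h
      rw [E₅.arg_eq_var_iff] at h
      rcases h with h | ⟨-, h⟩
      · exact E₅.ι_ne k' (hready₄ _ a h)
      · rw [hr₅] at h; cases h
    unfold fanout
    rw [Finset.sum_eq_zero]
    intro k' _
    rw [card_eq_zero, filter_eq_empty_iff]
    exact fun a _ h => h0 k' a h
  have hyp₃ : ¬ R₃.Protected y := fun h => hyp₂ ((RdqSource.protected_assignLin_iff hu₂ hup₂ hEq y).mp h)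
  -- accounting
  have htinf : t ∈ C.influential R := C.mem_influential_of_reads R hEt
  have hμ₁ := measure_substConst_le hφ' αI αQ C.isPacking_empty R R₁ t (finTwoEquiv c₁')
  have hinf₁ : (1 : ℝ) ≤ ((C.influential R).card : ℝ) - (C₁.influential R₁).card := by
    have h1 : (C₁.influential R₁).card ≤ ((C.influential R).erase t).card :=
      card_le_card (C.influential_substConst_assignFree_subset ht htp c₁' (finTwoEquiv c₁'))
    have h3 := card_erase_add_one htinf
    have : (C₁.influential R₁).card + 1 ≤ (C.influential R).card := by omega
    have : ((C₁.influential R₁).card : ℝ) + 1 ≤ (C.influential R).card := by exact_mod_cast this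
    linarith
  have hq₁ : ((R.quadCount : ℝ) - (R₁.quadCount : ℝ)) = 0 := by
    have : R₁.quadCount = R.quadCount := RdqSource.quadCount_assignFree ht htp; rw [this]; ring
  have hμE₁ := E₁.measure_le
  have hxinf₁ : x ∈ E₁.C'.influential R₁ := E₁.C'.mem_influential_of_reads R₁ hG₁x
  have hμ₂ := measure_substConst_le hφ' αI αQ E₁.packing R₁ R₂ x (finTwoEquiv c₂')
  have hinf₂ : (1 : ℝ) ≤ ((E₁.C'.influential R₁).card : ℝ) - (C₂.influential R₂).card := by
    have h1 : (C₂.influential R₂).card ≤ ((E₁.C'.influential R₁).erase x).card :=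
      card_le_card (E₁.C'.influential_substConst_assignFree_subset hx₁ hxp₁ c₂' (finTwoEquiv c₂'))
    have h3 := card_erase_add_one hxinf₁
    have : (C₂.influential R₂).card + 1 ≤ (E₁.C'.influential R₁).card := by omega
    have : ((C₂.influential R₂).card : ℝ) + 1 ≤ (E₁.C'.influential R₁).card := by exact_mod_cast this
    linarith
  have hq₂ : ((R₁.quadCount : ℝ) - (R₂.quadCount : ℝ)) = 0 := by
    have : R₂.quadCount = R₁.quadCount := RdqSource.quadCount_assignFree hx₁ hxp₁; rw [this]; ring
  have hμE₂ := E₂.measure_le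
  have hμE₃ := E₃.measure_le
  -- the affine substitution: `u` leaves
  have huinf₃ : u ∈ E₃.C'.influential R₂ := E₃.C'.mem_influential_of_reads R₂ hF₃u
  have hyinf₃ : y ∈ E₃.C'.influential R₂ := E₃.C'.mem_influential_of_reads R₂ hF₃y
  have hinf₄ : ((C₄.influential R₃).card : ℝ) + 1 ≤ (E₃.C'.influential R₂).card := by
    have hfreej : ¬ R₃.Free u := fun h => ((hfree u).mp h).2 rfl
    have hprot : ∀ i, R₃.Protected i → R₂.Protected i := fun i h => (RdqSource.protected_assignLin_iff hu₂ hup₂ hEq i).mp h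
    have h1 := E₃.C'.influential_substVar_subset u y (finTwoEquiv (0 : ZMod 2)) huy.symm hfreej hprot
    have h2 : insert y ((E₃.C'.influential R₂).erase u) = (E₃.C'.influential R₂).erase u :=
      insert_eq_of_mem (mem_erase.mpr ⟨huy.symm, hyinf₃⟩)
    rw [h2] at h1
    have h3 := card_le_card h1
    change (C₄.influential R₃).card ≤ _ at h3
    have h4 := card_erase_add_one huinf₃
    have : (C₄.influential R₃).card + 1 ≤ (E₃.C'.influential R₂).card := by omega
    exact_mod_cast this
  have hq₃ : (R₃.quadCount : ℝ) = R₂.quadCount := rfl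
  have hpot₄' : (C₄.potential P₄ : ℝ) ≤ E₃.C'.potential E₃.P' := by exact_mod_cast hpot₄
  have hμ₄ : C₄.measure αφ αI αQ P₄ R₃ ≤ E₃.C'.measure αφ αI αQ E₃.P' R₂ - αI := by
    unfold measure
    rw [hq₃]
    show ((E₃.C'.m : ℕ) : ℝ) + _ + _ + _ ≤ _
    nlinarith [mul_le_mul_of_nonneg_left hinf₄ hI', mul_le_mul_of_nonneg_left hpot₄' hφ']
  -- the last elimination: `y` leaves too
  have hyinf₄ : y ∈ C₄.influential R₃ := C₄.mem_influential_of_reads R₃ (hwF 0)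
  have hinf₅ : ((E₅.C'.influential R₃).card : ℝ) + 1 ≤ (C₄.influential R₃).card := by
    have hsub : E₅.C'.influential R₃ ⊆ (C₄.influential R₃).erase y := by
      intro i hi
      rw [mem_erase]
      refine ⟨fun hiy => ?_, E₅.influential_subset R₃ hi⟩
      rw [hiy] at hi
      unfold influential at hi; rw [mem_filter, hfy₅] at hi
      rcases hi.2 with h | h
      · omega
      · exact hyp₃ h
    have h1 := card_le_card hsub
    have h2 := card_erase_add_one hyinf₄
    have : (E₅.C'.influential R₃).card + 1 ≤ (C₄.influential R₃).card := by omega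
    exact_mod_cast this
  have hm₅ : (E₅.C'.m : ℝ) + 1 = C₄.m := by exact_mod_cast E₅.m_add_one
  have hpot₅ := E₅.potential_le
  have hμ₅ : E₅.C'.measure αφ αI αQ E₅.P' R₃ ≤ C₄.measure αφ αI αQ P₄ R₃ - αI := by
    unfold measure
    nlinarith [mul_le_mul_of_nonneg_left hinf₅ hI', mul_le_mul_of_nonneg_left hpot₅ hφ', hφ.le, hm₅]
  refine Or.inr ⟨3, by norm_num, le_rfl, E₅.C', R₃, E₅.P', E₅.fair, E₅.computes, E₅.packing, by omega, ?_⟩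
  have hδ := three_liYangDelta_le_four αφ αI αQ
  rw [hq₁] at hμ₁; rw [hq₂] at hμ₂
  have hαI₁ := mul_le_mul_of_nonneg_left hinf₁ hI'
  have hαI₂ := mul_le_mul_of_nonneg_left hinf₂ hI'
  push_cast
  linarith [hμ₁, hμE₁, hμ₂, hμE₂, hμE₃, hμ₄, hμ₅, hαI₁, hαI₂]

end Semicircuit

end Literature.Computability.Complexity
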